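import Literature.NumberTheory.EllipticCurves.Rank1Residual.Predicates
import Literature.NumberTheory.EllipticCurves.TateModuleTwistTransportProofs
import Literature.NumberTheory.EllipticCurves.TateModuleFinrankProofs
import Literature.NumberTheory.EllipticCurves.TateModuleFreeProofs
import Literature.NumberTheory.EllipticCurves.FrobeniusTateModuleProofs
import Literature.NumberTheory.EllipticCurves.BSDInvariantsProofs
import HarnessLib

/-!
# Hypothesis (Im) passes to quadratic twists and to `ℚ`-isomorphic models (odd `p`)

Topic `NumberTheory/EllipticCurves`; theorems only (no definition, no named fact). Cell `pub/bsd-littype`,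
seat `bsd-littype-04` gen 6; OPEN-QUESTIONS-04 Q24 (d). HONEST FRAMING: typed ≠ proved ≠ endorsed; this
is a kernel edge making a hypothesis of `YanZhu2026/OrdinaryMainConjectureEqualityProofs.lean` §D
(`BigIm W' p` for a minimal model `W'` of the twist `E^K`) follow from print's hypothesis (`BigIm W p`,
i.e. (Im) for `E` itself).

(Im) (Burungale–Castella–Skinner, IMRN 2025, p. 2; Yan–Zhu, J. Algebra 693 (2026), Thm. 4.2; Kato,
Astérisque 295, Thm. 13.4 (3); tree predicate `Literature.NumberTheory.EllipticCurves.Rank1Residual.BigIm`):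
"there exists `τ ∈ Gal(ℚ̄/ℚ(μ_{p^∞}))` such that `T_pE/(ρ_E(τ) − 1)T_pE` is free of rank one over `ℤ_p`".

**Theorem** (`bigIm_quadraticTwist`, `bigIm_of_smul_eq_quadraticTwist`). For `E = W/ℚ` elliptic, `p`
an ODD prime and `d ≠ 0`: (Im) for `E` implies (Im) for the quadratic twist `E^{(d)}` (any model
`ℚ`-isomorphic to `W.quadraticTwist d`). Proof (folklore; the remark behind "[Kato, Thm. 17.4] for `E`
and `E^K`" in Yan–Zhu's proof of Thm. 4.2, v4 TeX l.1050–1056): let `σ ∈ G_{ℚ(μ_{p^∞})}` with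
`T/(σ − 1)T ≅ ℤ_p`, `T = T_pE ≅ ℤ_p²`. Then `det ρ(σ) = χ_p(σ) = 1` (Weil pairing, tree
`det_galoisRepTate_eq_cyclotomicCharacter_holds`; `χ_p(σ) = 1` since `σ` fixes `μ_{p^∞}`,
`cyclotomicCharacter_eq_one_of_forall_pow_eq_one`), and `det(ρ(σ) − 1) = 0` (an endomorphism of `ℤ_p²`
with non-zero determinant `δ` has cokernel killed by `δ`, `A · adj A = δ`, whereas `ℤ_p` is
torsion-free); for a `2 × 2` matrix these two give `tr ρ(σ) = 2` and, by Cayley–Hamilton, `N² = 0` for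
`N = ρ(σ) − 1` (§1, `sq_eq_zero_of_det_eq_one_of_det_sub_one_eq_zero`, checked on entries). Hence
`ρ(σ²) − 1 = N(N + 2) = 2N` has the same image as `N` (`2 ∈ ℤ_pˣ`, `p` odd), so `T/(σ² − 1)T =
T/(σ − 1)T ≅ ℤ_p` (§2). Now `σ² ∈ G_{ℚ(√d)}` (`σ√d = ±√d`), and over `G_{ℚ(√d)}` the Tate modules of `E`
and `E^{(d)}` are isomorphic (`exists_addEquiv_geomPoints_quadraticTwist`, Silverman X.5.4), so
`T_p E^{(d)}/(σ² − 1) ≅ ℤ_p` (§3, transport of the cokernel along an equivariant isomorphism of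
geometric points through the functor `T_p`, `TateModule.map`); `σ²` still fixes `μ_{p^∞}`. A change of
variables `C • W' = W.quadraticTwist d` is `Γ_ℚ`-equivariant on points (`geomPointsEquiv`), so (Im)
transfers to `W'` with the same element (§3).

## References
* [BurungaleCastellaSkinner2025] IMRN 2025 (rnaf082) = arXiv:2405.00270v2, p. 2, hypothesis (im).
* [YanZhu2024MainConjNonCM] J. Algebra 693 (2026) = arXiv:2412.20078v4, Thm. 4.2 (Im) and proof
  l.1050–1056 ("[Kato, Theorem 17.4]" for `E` and `E^K`).
* [Kato2004Asterisque] Astérisque 295 (2004), Thm. 13.4 (3), (12.5.2).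
* [SilvermanAEC2009] III.§7–8 (Tate module, `det = χ`), X.5 Cor. 5.4 (twists).
-/

noncomputable section

open scoped Classical

universe u

open WeierstrassCurve Field Literature.NumberTheory.EllipticCurves Literature.NumberTheory.GaloisRepresentations

namespace Literature.NumberTheory.EllipticCurves.Rank1Residual

/-! ## §1. `2 × 2` linear algebra: `det A = 1`, `det(A − 1) = 0` ⟹ `(A − 1)² = 0` -/

/-- For a `2 × 2` matrix over a commutative ring: `det A = 1` and `det(A − 1) = 0` give `tr A = 2`,
the characteristic polynomial `(X − 1)²`, and by Cayley–Hamilton `(A − 1)² = 0` (checked on entries).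
[cite: SilvermanAEC2009, III.§8 (det ρ_ℓ = χ_ℓ; unipotent elements of SL₂)] -/
theorem sq_eq_zero_of_det_eq_one_of_det_sub_one_eq_zero {R : Type*} [CommRing R]
    (A : Matrix (Fin 2) (Fin 2) R) (h1 : A.det = 1) (h0 : (A - 1).det = 0) :
    (A - 1) * (A - 1) = 0 := by
  rw [Matrix.det_fin_two] at h1 h0
  simp only [Matrix.sub_apply, Matrix.one_apply_eq, Matrix.one_apply_ne (by decide : (0 : Fin 2) ≠ 1),
    Matrix.one_apply_ne (by decide : (1 : Fin 2) ≠ 0), sub_zero] at h0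
  ext i j
  fin_cases i <;> fin_cases j <;>
    simp only [Matrix.mul_apply, Fin.sum_univ_two, Matrix.sub_apply, Matrix.one_apply_eq,
      Matrix.one_apply_ne (by decide : (0 : Fin 2) ≠ 1), Matrix.one_apply_ne (by decide : (1 : Fin 2) ≠ 0),
      sub_zero, Matrix.zero_apply, Fin.zero_eta, Fin.mk_one, Fin.isValue]
  · linear_combination (A 0 0 - 1) * h1 - (A 0 0) * h0
  · linear_combination (A 0 1) * h1 - (A 0 1) * h0
  · linear_combination (A 1 0) * h1 - (A 1 0) * h0
  · linear_combination (A 1 1 - 1) * h1 - (A 1 1) * h0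

/-! ## §2. On a free `ℤ_p`-module of rank `2` (`p` odd): `det M = 1` and `T/(M − 1) ≅ ℤ_p` ⟹
`T/(M² − 1) ≅ ℤ_p` -/

section Rank2

variable {p : ℕ} [Fact p.Prime] {T : Type*} [AddCommGroup T] [Module ℤ_[p] T]

/-- The determinant of an endomorphism of a finite free module kills its cokernel: `det f • x ∈ range f`
(`A · adj A = det A · 1`). [cite: SilvermanAEC2009, III.§7 (T_ℓ E ≅ ℤ_ℓ², endomorphisms as 2×2 matrices)] -/
theorem det_smul_mem_range {ι : Type*} [Fintype ι] [DecidableEq ι] (b : Module.Basis ι ℤ_[p] T)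
    (f : T →ₗ[ℤ_[p]] T) (x : T) : LinearMap.det f • x ∈ LinearMap.range f := by
  set A := LinearMap.toMatrix b b f with hA
  have key : f.comp (Matrix.toLin b b A.adjugate) = LinearMap.det f • LinearMap.id := by
    apply (LinearMap.toMatrix b b).injective
    rw [LinearMap.toMatrix_comp b b b, LinearMap.toMatrix_toLin, ← hA, Matrix.mul_adjugate, map_smul,
      LinearMap.toMatrix_id, hA, LinearMap.det_toMatrix]
  refine ⟨Matrix.toLin b b A.adjugate x, ?_⟩
  have := LinearMap.congr_fun key x
  simpa using this

/-- **`det M = 1`, `T/(M − 1)T ≅ ℤ_p` ⟹ `(M − 1)² = 0`** on a free `ℤ_p`-module `T` of rank `2`: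
`det(M − 1)` kills the cokernel `≅ ℤ_p`, which is torsion-free, so `det(M − 1) = 0`; then §1.
[cite: SilvermanAEC2009, III.§7–8] -/
theorem sub_one_mul_sub_one_eq_zero [Module.Free ℤ_[p] T] [Module.Finite ℤ_[p] T]
    (hT : Module.finrank ℤ_[p] T = 2) (M : T →ₗ[ℤ_[p]] T) (hdet : LinearMap.det M = 1)
    (hq : Nonempty ((T ⧸ LinearMap.range (M - LinearMap.id)) ≃ₗ[ℤ_[p]] ℤ_[p])) :
    (M - LinearMap.id) * (M - LinearMap.id) = 0 := by
  obtain ⟨ψ⟩ := hq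
  let b := Module.finBasisOfFinrankEq ℤ_[p] T hT
  set N := M - LinearMap.id with hN
  -- `det N` kills `T/N(T) ≅ ℤ_p`, hence `det N = 0`
  have hdetN : LinearMap.det N = 0 := by
    set q := ψ.symm 1 with hq_def
    obtain ⟨x, hx⟩ := Submodule.Quotient.mk_surjective (LinearMap.range N) q
    have h1 : LinearMap.det N • q = 0 := by
      rw [← hx, ← Submodule.Quotient.mk_smul, Submodule.Quotient.mk_eq_zero]
      exact det_smul_mem_range b N x
    have h2 : LinearMap.det N • (1 : ℤ_[p]) = 0 := by
      have := congrArg ψ h1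
      rwa [map_smul, map_zero, hq_def, LinearEquiv.apply_symm_apply] at this
    simpa using h2
  -- pass to `2 × 2` matrices
  apply (LinearMap.toMatrix b b).injective
  have hA1 : (LinearMap.toMatrix b b M).det = 1 := by rw [LinearMap.det_toMatrix, hdet]
  have hA0 : (LinearMap.toMatrix b b M - 1).det = 0 := by
    rw [← LinearMap.toMatrix_id (v₁ := b), ← map_sub, LinearMap.det_toMatrix, ← hN, hdetN]
  rw [LinearMap.toMatrix_mul, map_zero, hN, map_sub, LinearMap.toMatrix_id]
  exact sq_eq_zero_of_det_eq_one_of_det_sub_one_eq_zero _ hA1 hA0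

/-- **`T/(M² − 1)T = T/(M − 1)T`** under the same hypotheses, for `p` odd: `M² − 1 = (M − 1)(M + 1) =
(M − 1)² + 2(M − 1) = 2(M − 1)` and `2 ∈ ℤ_pˣ`, so the two images coincide.
[cite: SilvermanAEC2009, III.§7–8] -/
theorem range_mul_self_sub_one_eq [Module.Free ℤ_[p] T] [Module.Finite ℤ_[p] T] (hp : p ≠ 2)
    (hT : Module.finrank ℤ_[p] T = 2) (M : T →ₗ[ℤ_[p]] T) (hdet : LinearMap.det M = 1)
    (hq : Nonempty ((T ⧸ LinearMap.range (M - LinearMap.id)) ≃ₗ[ℤ_[p]] ℤ_[p])) :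
    LinearMap.range (M * M - LinearMap.id) = LinearMap.range (M - LinearMap.id) := by
  have hsq := sub_one_mul_sub_one_eq_zero hT M hdet hq
  -- `M² − 1 = 2 (M − 1)`
  have hfactor : M * M - LinearMap.id = (2 : ℤ_[p]) • (M - LinearMap.id) := by
    have h1 : M * M - LinearMap.id =
        (M - LinearMap.id) * (M - LinearMap.id) + (2 : ℤ_[p]) • (M - LinearMap.id) := by
      rw [two_smul, ← Module.End.one_eq_id]
      noncomm_ring
    rw [h1, hsq, zero_add]
  -- `2` is a unit of `ℤ_p` (`p` odd)
  have h2 : IsUnit (2 : ℤ_[p]) := by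
    rw [PadicInt.isUnit_iff]
    have hlt : ¬ ‖((2 : ℤ) : ℤ_[p])‖ < 1 := by
      rw [PadicInt.norm_int_lt_one_iff_dvd]
      intro h
      have h' : (p : ℤ) ∣ (2 : ℕ) := by exact_mod_cast h
      have hp2 : p ∣ 2 := Int.natCast_dvd_natCast.mp h'
      exact hp ((Nat.prime_dvd_prime_iff_eq (Fact.out : p.Prime) Nat.prime_two).mp hp2)
    have hle := PadicInt.norm_le_one ((2 : ℤ) : ℤ_[p])
    push_cast at hlt hle
    exact le_antisymm hle (not_lt.mp hlt)
  obtain ⟨u, hu⟩ := h2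
  rw [hfactor]
  apply le_antisymm
  · rintro _ ⟨y, rfl⟩
    exact ⟨(2 : ℤ_[p]) • y, by rw [LinearMap.smul_apply, map_smul]⟩
  · rintro _ ⟨y, rfl⟩
    refine ⟨((u⁻¹ : ℤ_[p]ˣ) : ℤ_[p]) • y, ?_⟩
    rw [LinearMap.smul_apply, map_smul, smul_smul, ← hu, Units.mul_inv, one_smul]

end Rank2

/-! ## §3. Transport of the (Im)-cokernel along an equivariant isomorphism of geometric points -/

section Transport

variable (p : ℕ) [Fact p.Prime]

/-- **`T_p` of a `σ`-equivariant isomorphism of geometric points identifies the cokernels of `σ − 1`**: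
for Weierstrass curves `W₁, W₂` over `F` and an additive isomorphism `e : W₁(F̄) ≃+ W₂(F̄)` commuting
with a given `σ ∈ Γ_F`, `T_pW₁/(σ − 1) ≅ T_pW₂/(σ − 1)`; in particular the rank-one-cokernel condition
of (Im) passes from `W₁` to `W₂`. [cite: SilvermanAEC2009, III.§7 (functoriality of T_ℓ)] -/
theorem nonempty_quotient_equiv_of_addEquiv {F : Type u} [Field F] {W₁ W₂ : WeierstrassCurve F}
    (e : W₁.geomPoints ≃+ W₂.geomPoints) (σ : absoluteGaloisGroup F)
    (he : ∀ P, e (σ • P) = σ • e P)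
    (h : Nonempty ((W₁.tateModule p ⧸ LinearMap.range (W₁.galoisRepTate p σ - LinearMap.id)) ≃ₗ[ℤ_[p]]
      ℤ_[p])) :
    Nonempty ((W₂.tateModule p ⧸ LinearMap.range (W₂.galoisRepTate p σ - LinearMap.id)) ≃ₗ[ℤ_[p]]
      ℤ_[p]) := by
  obtain ⟨ψ⟩ := h
  -- `T_p e : T_p W₁ ≃ T_p W₂`
  let E : W₁.tateModule p ≃ₗ[ℤ_[p]] W₂.tateModule p :=
    LinearEquiv.ofLinear (TateModule.map p e.toAddMonoidHom) (TateModule.map p e.symm.toAddMonoidHom)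
      (by
        rw [← TateModule.map_comp]
        convert TateModule.map_id (A := W₂.geomPoints) (p := p) using 2
        ext P; simp)
      (by
        rw [← TateModule.map_comp]
        convert TateModule.map_id (A := W₁.geomPoints) (p := p) using 2
        ext P; simp)
  -- equivariance: `E ∘ (σ − 1) = (σ − 1) ∘ E`
  have hE : (E : W₁.tateModule p →ₗ[ℤ_[p]] W₂.tateModule p).comp (W₁.galoisRepTate p σ - LinearMap.id) =
      (W₂.galoisRepTate p σ - LinearMap.id).comp (E : W₁.tateModule p →ₗ[ℤ_[p]] W₂.tateModule p) := by
    apply LinearMap.ext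
    intro a
    apply TateModule.ext
    intro n
    simp [E, he]
  have hrange : (LinearMap.range (W₁.galoisRepTate p σ - LinearMap.id)).map
      (E : W₁.tateModule p →ₗ[ℤ_[p]] W₂.tateModule p) =
      LinearMap.range (W₂.galoisRepTate p σ - LinearMap.id) := by
    rw [LinearMap.range_eq_map, ← Submodule.map_comp, hE, Submodule.map_comp, Submodule.map_top,
      LinearEquiv.range, ← LinearMap.range_eq_map]
  exact ⟨(Submodule.Quotient.equiv _ _ E hrange).symm.trans ψ⟩

end Transport

/-! ## §4. (Im) for `E` ⟹ (Im) for `E^{(d)}` and for every `ℚ`-isomorphic model -/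

section Assembly

variable (p : ℕ) [Fact p.Prime]

/-- **(Im) is invariant under a change of variables**: if `C • W₁ = W₂` then `BigIm W₂ p → BigIm W₁ p`
(the substitution `W₁(ℚ̄) ≃+ W₂(ℚ̄)` is `Γ_ℚ`-equivariant, §3 with the same `σ`).
[cite: SilvermanAEC2009, III.3.1(b) and III.§7] -/
theorem bigIm_of_smul_eq {W₁ W₂ : WeierstrassCurve ℚ} {C : VariableChange ℚ} (hC : C • W₁ = W₂)
    (h : BigIm W₂ p) : BigIm W₁ p := by
  subst hC
  obtain ⟨σ, hσ, hq⟩ := h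
  exact ⟨σ, hσ, nonempty_quotient_equiv_of_addEquiv p (geomPointsEquiv W₁ C).symm σ
    (fun P ↦ by
      apply (geomPointsEquiv W₁ C).injective
      rw [AddEquiv.apply_symm_apply, geomPointsEquiv_smul, AddEquiv.apply_symm_apply]) hq⟩

/-- **(Im) for `E` gives (Im) with the SQUARE of the element**: if `σ ∈ G_{ℚ(μ_{p^∞})}` has
`T_pE/(σ − 1) ≅ ℤ_p` then so does `σ²` (`p` odd; §2 with `det ρ(σ) = χ_p(σ) = 1`).
[cite: SilvermanAEC2009, III.§8 (Prop. III.8.1, III.8.3: det ρ_ℓ = χ_ℓ)] -/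
theorem nonempty_quotient_equiv_sq (W : WeierstrassCurve ℚ) [W.IsElliptic] (hp : p ≠ 2)
    (σ : absoluteGaloisGroup ℚ)
    (hσ : ∀ ζ : AlgebraicClosure ℚ, ∀ n : ℕ, ζ ^ p ^ n = 1 → absoluteGaloisGroup.toAlgEquiv ℚ σ ζ = ζ)
    (hq : Nonempty ((W.tateModule p ⧸ LinearMap.range (W.galoisRepTate p σ - LinearMap.id)) ≃ₗ[ℤ_[p]]
      ℤ_[p])) :
    Nonempty ((W.tateModule p ⧸ LinearMap.range (W.galoisRepTate p (σ * σ) - LinearMap.id)) ≃ₗ[ℤ_[p]]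
      ℤ_[p]) := by
  haveI : Module.Free ℤ_[p] (W.tateModule p) := module_free_tateModule_holds W p
  haveI : Module.Finite ℤ_[p] (W.tateModule p) := module_finite_tateModule_holds W p
  have hp0 : (p : ℚ) ≠ 0 := by exact_mod_cast (Fact.out : p.Prime).ne_zero
  have hT : Module.finrank ℤ_[p] (W.tateModule p) = 2 := finrank_tateModule_eq_two_holds W p hp0
  -- `det ρ(σ) = χ_p(σ) = 1`
  have hχ : GaloisRep.cyclotomicCharacter ℚ p σ = 1 := by
    rw [GaloisRep.cyclotomicCharacter_apply]
    exact cyclotomicCharacter_eq_one_of_forall_pow_eq_one p _ fun n t ht ↦ hσ t n ht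
  have hdet : LinearMap.det (W.galoisRepTate p σ) = 1 := by
    rw [det_galoisRepTate_eq_cyclotomicCharacter_holds W (ℓ := p) hp0 σ, hχ, Units.val_one]
  rw [map_mul, range_mul_self_sub_one_eq hp hT _ hdet hq]
  exact hq

/-- **(Im) passes to quadratic twists** (`p` odd, `d ≠ 0`): `BigIm W p → BigIm (W.quadraticTwist d) p`,
with the element `σ²`, which lies in `G_{ℚ(√d)}` where `E^{(d)}(ℚ̄) ≅ E(ℚ̄)` equivariantly
(`exists_addEquiv_geomPoints_quadraticTwist`). This is the remark making "[Kato, Thm. 17.4] for `E^K`"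
available under (Im) for `E` in the proof of [YZ26, Thm. 4.2]. [cite: SilvermanAEC2009, X.5 Cor. 5.4 and III.§8]
[cite: YanZhu2024MainConjNonCM, proof of Thm. 4.2, last paragraph (arXiv:2412.20078v4 TeX l.1050–1056)] -/
theorem bigIm_quadraticTwist (W : WeierstrassCurve ℚ) [W.IsElliptic] (hp : p ≠ 2) {d : ℚ} (hd : d ≠ 0)
    (h : BigIm W p) : BigIm (W.quadraticTwist d) p := by
  obtain ⟨σ, hσ, hq⟩ := h
  obtain ⟨f, hf⟩ := exists_addEquiv_geomPoints_quadraticTwist W hd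
  -- `σ² √d = √d`
  have hσd : (σ * σ) • geomSqrt d = geomSqrt d := by
    have hmem : σ • geomSqrt d ∈ MulAction.orbit (absoluteGaloisGroup ℚ) (geomSqrt d) :=
      MulAction.mem_orbit _ σ
    rcases orbit_geomSqrt_subset d hmem with h1 | h1
    · rw [mul_smul, h1, h1]
    · rw [Set.mem_singleton_iff] at h1
      rw [mul_smul, h1, smul_neg, h1, neg_neg]
  refine ⟨σ * σ, fun ζ n hζ ↦ ?_, ?_⟩
  · rw [map_mul, AlgEquiv.mul_apply, hσ ζ n hζ, hσ ζ n hζ]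
  · exact nonempty_quotient_equiv_of_addEquiv p f.symm (σ * σ)
      (fun P ↦ by
        apply f.injective
        rw [AddEquiv.apply_symm_apply, hf (σ * σ) hσd, AddEquiv.apply_symm_apply])
      (nonempty_quotient_equiv_sq p W hp σ hσ hq)

/-- **(Im) for `E` ⟹ (Im) for any globally chosen model `W'` of the twist `E^{(d)}`**
(`C • W' = W.quadraticTwist d`, the tree's spelling): the hypothesis `BigIm W' p` of
`YanZhu2026.spanLeIdeal_perrinRiou_of_facts_of_minimalTwist` follows from print's (Im) for `E`.
[cite: YanZhu2024MainConjNonCM, Thm. 4.2 (Im) clause (arXiv:2412.20078v4 TeX l.944–949)]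
[cite: SilvermanAEC2009, X.5 Cor. 5.4] -/
theorem bigIm_of_smul_eq_quadraticTwist (W W' : WeierstrassCurve ℚ) [W.IsElliptic] (hp : p ≠ 2)
    {d : ℚ} (hd : d ≠ 0) {C : VariableChange ℚ} (hC : C • W' = W.quadraticTwist d) (h : BigIm W p) :
    BigIm W' p :=
  bigIm_of_smul_eq p hC (bigIm_quadraticTwist p W hp hd h)

end Assembly

end Literature.NumberTheory.EllipticCurves.Rank1Residual

end
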